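import Literature.AlgebraicGeometry.Resolution.QuasiProjectiveResolution
import Literature.AlgebraicGeometry.Resolution.ResolutionOfSingularities
import Literature.AlgebraicGeometry.Resolution.RegularLocalRingsProofs
import Mathlib.AlgebraicGeometry.Morphisms.Etale
import Mathlib.AlgebraicGeometry.Morphisms.FiniteType
import Mathlib.AlgebraicGeometry.Morphisms.Proper
import Mathlib.AlgebraicGeometry.Cover.Open
import Mathlib.Algebra.DirectSum.Internal
import Mathlib.RingTheory.RegularLocalRing.Defs
import HarnessLib

/-!
# Crux `FRationalResolution`, line `redirect`: the stub `stub_quotientModel` follows from a resolution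

Support file for crux stmt-ResolutionOfSingularities-15317 (`FrobeniusLadder.FRationalResolution`), skeleton of record
31452a5ba582e46f (line `redirect`). KILL-CRITERION bookkeeping for the registered open stub `stub_quotientModel`
(«lrq-ification»: a proper birational integral model with diagonalizable quotient singularities presented by regular charts):
its CONCLUSION holds for every integral separated finite-type `X/k` that admits a resolution of singularities, with the
resolution as the model and the TRIVIAL grading (`A = PUnit`) on the affine charts of the (regular) resolution.

* `quotientChart_of_isRegular` — every point of a REGULAR scheme `Y`, locally of finite type over a field `k`, lies in the image
  of an étale `k`-morphism `Spec S₀ → Y` with `S` a finitely generated regular `k`-algebra graded by a finite abelian group and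
  `S₀` its degree-`0` part — namely an affine chart `Spec R → Y` of the affine cover, `S = R` graded trivially by `PUnit`
  (`S₀ = S`), the `k`-algebra structure on `R` being read off the morphism `Spec R → Y → Spec k` (`Spec.preimage`), of finite
  type by `HasRingHomProperty.Spec_iff`, regular because its localizations are the stalks of `Y` (`Spec.stalkIso`, stalk
  isomorphisms of an open immersion);
* `quotientModel_of_hasResolution` — hence the conclusion of `stub_quotientModel` for every integral `X` with
  `Scheme.HasResolution X` (the source of a resolution is integral: reduced with domain stalks, irreducible by
  `IsBirational.irreducibleSpace`);
* `quotientModel_of_cossartPiltant2019_of_dim_le_three` — so in dimension `≤ 3` the stub's conclusion holds CONDITIONALLY on the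
  named fact `CossartPiltant2019`.
Consequently `stub_quotientModel` — which quantifies `∃ X'` over all proper birational models — is NOT refutable short of
`¬ResolutionOfSingularities` and is open exactly where the summit is (dimension `≥ 4`); only its model-free reading («`X` itself
is étale-locally a diagonalizable quotient») could fail. Companion of `…StubsOfHasResolution.lean` (the other two model stubs).
[folklore; StacksProject Tag 01RN, Tag 02IS]
-/

-- single-problem summit: the doubled namespace component is forced
set_option linter.dupNamespace false

noncomputable section

open CategoryTheory AlgebraicGeometry TopologicalSpace
open Literature.AlgebraicGeometry.Resolution

namespace Summit.ResolutionOfSingularities.ResolutionOfSingularities.Theorems.FRationalResolution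

universe u in
/-- The trivial grading of an algebra by `PUnit` (everything in degree `0`) is a graded algebra: the decomposition is
`b ↦ of () b`. [folklore] -/
theorem exists_gradedAlgebra_trivial (k : Type) [Field k] (S : Type u) [CommRing S] [Algebra k S] :
    ∃ _ : GradedAlgebra (fun _ : PUnit.{1} => (⊤ : Submodule k S)), True := by
  classical
  let 𝒮 : PUnit.{1} → Submodule k S := fun _ => ⊤
  haveI hGM : SetLike.GradedMonoid 𝒮 :=
    { one_mem := Submodule.mem_top
      mul_mem := fun _ _ _ _ _ _ => Submodule.mem_top }
  let dec : S → DirectSum PUnit.{1} (fun i => ↥(𝒮 i)) := fun b =>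
    DirectSum.of (fun i => ↥(𝒮 i)) PUnit.unit ⟨b, Submodule.mem_top⟩
  have hdec_add : ∀ b c : S, dec (b + c) = dec b + dec c := by
    intro b c
    simp only [dec, ← map_add]
    rfl
  have hright : Function.RightInverse (DirectSum.coeAddMonoidHom 𝒮) dec := by
    intro d
    induction d using DirectSum.induction_on with
    | zero =>
      have h0 : dec 0 = 0 := by
        have : (⟨(0 : S), Submodule.mem_top⟩ : ↥(𝒮 PUnit.unit)) = 0 := rfl
        simp only [dec, this, map_zero]
      simpa using h0
    | of i x =>
      cases i
      simp only [DirectSum.coeAddMonoidHom_of, dec]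
    | add x y hx hy =>
      rw [map_add, hdec_add, hx, hy]
  let D : DirectSum.Decomposition 𝒮 :=
    { decompose' := dec, left_inv := fun b => by simp [dec], right_inv := hright }
  exact ⟨{ toGradedMonoid := hGM, toDecomposition := D }, trivial⟩

/-- **Regular schemes over a field have (trivial) diagonalizable-quotient charts.** Let `Y` be a regular scheme, locally of
finite type over a field `k` via `g`. Every `y ∈ Y` lies in the image of an étale `k`-morphism `Spec S₀ → Y` where `S` is a
finitely generated REGULAR `k`-algebra graded by a finite abelian group `A` and `S₀` its degree-`0` part: take an affine chart
`Spec R → Y` of the affine cover through `y`, `A = PUnit`, `S = R` with the trivial grading (so `S₀ = S`), the `k`-structure of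
`R` read off `Spec R → Y → Spec k` (`Spec.preimage`). `R` is of finite type (`HasRingHomProperty.Spec_iff` for
`LocallyOfFiniteType`) and regular (its localizations at primes are the stalks of `Spec R`, `Spec.stalkIso`, which are stalks
of `Y` along the open immersion). [folklore; StacksProject Tag 02IS] -/
theorem quotientChart_of_isRegular (k : Type) [Field k] (Y : Scheme.{0}) (g : Y ⟶ Spec (.of k))
    [LocallyOfFiniteType g] (hY : Scheme.IsRegular Y) (y : Y) :
    ∃ (A : Type) (_ : AddCommGroup A) (_ : Finite A) (_ : DecidableEq A)
        (S : Type) (_ : CommRing S) (_ : Algebra k S) (𝒮 : A → Submodule k S)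
        (_ : GradedAlgebra 𝒮), Algebra.FiniteType k S ∧ IsRegularRing S ∧
        ∃ φ : Spec (.of (𝒮 0)) ⟶ Y, Etale φ ∧ y ∈ Set.range φ ∧
          φ ≫ g = Spec.map (CommRingCat.ofHom (algebraMap k (𝒮 0))) := by
  classical
  -- an affine open `V ∋ y` and its chart `ι = hV.fromSpec : Spec Γ(Y, V) → Y`
  obtain ⟨_, ⟨V, hV, rfl⟩, hyV, -⟩ :=
    Y.isBasis_affineOpens.exists_subset_of_mem_open (Set.mem_univ y) isOpen_univ
  have hV' : IsAffineOpen V := hV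
  -- the `k`-algebra structure of `Γ(Y, V)` read off `Spec Γ(Y, V) → Y → Spec k`
  let ψ : CommRingCat.of k ⟶ Γ(Y, V) := Spec.preimage (hV'.fromSpec ≫ g)
  have hψ : hV'.fromSpec ≫ g = Spec.map ψ := (Spec.map_preimage _).symm
  letI : Algebra k Γ(Y, V) := ψ.hom.toAlgebra
  -- finite type
  have hft : Algebra.FiniteType k Γ(Y, V) := by
    have h : LocallyOfFiniteType (Spec.map ψ) := by rw [← hψ]; infer_instance
    exact (HasRingHomProperty.Spec_iff (P := @LocallyOfFiniteType)).mp h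
  -- regular: the localizations of `Γ(Y, V)` at primes are stalks of `Y`
  haveI : IsNoetherianRing Γ(Y, V) := Algebra.FiniteType.isNoetherianRing k _
  have hreg : IsRegularRing Γ(Y, V) := by
    refine isRegularRing_iff.mpr fun P hP => ?_
    let z : Spec Γ(Y, V) := ⟨P, hP⟩
    haveI : IsRegularLocalRing (Y.presheaf.stalk (hV'.fromSpec z)) := hY _
    haveI : IsRegularLocalRing ((Spec Γ(Y, V)).presheaf.stalk z) :=
      IsRegularLocalRing.of_ringEquiv (asIso (hV'.fromSpec.stalkMap z)).commRingCatIsoToRingEquiv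
    exact IsRegularLocalRing.of_ringEquiv (Spec.stalkIso Γ(Y, V) z).commRingCatIsoToRingEquiv
  -- the trivial grading by `PUnit`
  obtain ⟨hGA, -⟩ := exists_gradedAlgebra_trivial k Γ(Y, V)
  let 𝒮 : PUnit.{1} → Submodule k Γ(Y, V) := fun _ => ⊤
  letI : GradedAlgebra 𝒮 := hGA
  -- `S ≅ S₀` as `k`-algebras, and the chart
  let e : Γ(Y, V) ≃ₐ[k] ↥(SetLike.GradeZero.subalgebra 𝒮) :=
    AlgEquiv.ofBijective ((AlgHom.id k Γ(Y, V)).codRestrict (SetLike.GradeZero.subalgebra 𝒮)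
      fun b => (Submodule.mem_top : b ∈ (⊤ : Submodule k Γ(Y, V))))
      ⟨fun a b h => congrArg Subtype.val h, fun b => ⟨b.1, Subtype.ext rfl⟩⟩
  let ιe : CommRingCat.of ↑Γ(Y, V) ≅ CommRingCat.of ↥(SetLike.GradeZero.subalgebra 𝒮) := e.toRingEquiv.toCommRingCatIso
  refine ⟨PUnit.{1}, inferInstance, inferInstance, inferInstance, Γ(Y, V), inferInstance, inferInstance, 𝒮, hGA,
    hft, hreg, Spec.map ιe.hom ≫ hV'.fromSpec, inferInstance, ?_, ?_⟩
  · -- `y ∈ V = range ι`, and `Spec.map ιe.hom` is surjective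
    have hy : y ∈ Set.range hV'.fromSpec := by rw [hV'.range_fromSpec]; exact hyV
    obtain ⟨x', hx'⟩ := hy
    obtain ⟨x'', rfl⟩ := (Spec.map ιe.hom).surjective x'
    exact ⟨x'', by rw [Scheme.Hom.comp_apply]; exact hx'⟩
  · -- `ι ≫ g = Spec.map ψ` and `ψ ≫ ιe.hom = algebraMap k S₀` (definitionally: `e` is the corestriction of the identity)
    rw [Category.assoc, hψ, ← Spec.map_comp]
    congr 1

/-- **`stub_quotientModel` ⟸ a resolution.** If the integral separated finite-type `X/k` has a resolution of singularities
`π : X' → X`, then `π` is a proper birational INTEGRAL model every point of which lies in the image of an étale `k`-morphism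
from the degree-`0` part of a finitely generated regular `k`-algebra graded by a finite abelian group
(`quotientChart_of_isRegular`, trivial grading on the affine charts of the regular `X'`). The stub's weak-F-regularity
hypothesis is not used. [folklore] -/
theorem quotientModel_of_hasResolution (k : Type) [Field k] (X : Scheme.{0}) (f : X ⟶ Spec (.of k))
    [LocallyOfFiniteType f] [IsIntegral X] (hres : Scheme.HasResolution X) :
    ∃ (X' : Scheme.{0}) (π : X' ⟶ X), IsProper π ∧ IsBirational π ∧ IsIntegral X' ∧
      ∀ x : X', ∃ (A : Type) (_ : AddCommGroup A) (_ : Finite A) (_ : DecidableEq A)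
        (S : Type) (_ : CommRing S) (_ : Algebra k S) (𝒮 : A → Submodule k S)
        (_ : GradedAlgebra 𝒮), Algebra.FiniteType k S ∧ IsRegularRing S ∧
        ∃ φ : Spec (.of (𝒮 0)) ⟶ X', Etale φ ∧ x ∈ Set.range φ ∧
          φ ≫ π ≫ f = Spec.map (CommRingCat.ofHom (algebraMap k (𝒮 0))) := by
  obtain ⟨X', π, hπ⟩ := hres
  haveI := hπ.isProper
  -- the source of a resolution of an integral scheme is integral
  haveI : ∀ x : X', _root_.IsReduced (X'.presheaf.stalk x) := fun x => by
    haveI : IsRegularLocalRing (X'.presheaf.stalk x) := hπ.isRegular x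
    haveI : IsDomain (X'.presheaf.stalk x) := isDomain_of_isRegularLocalRing _
    infer_instance
  haveI : IsReduced X' := isReduced_of_isReduced_stalk X'
  haveI : IrreducibleSpace X' := IsBirational.irreducibleSpace hπ.isBirational
  haveI : IsIntegral X' := isIntegral_of_irreducibleSpace_of_isReduced X'
  exact ⟨X', π, hπ.isProper, hπ.isBirational, ‹_›, fun x => quotientChart_of_isRegular k X' (π ≫ f) hπ.isRegular x⟩

/-- **`stub_quotientModel` in dimension `≤ 3`, modulo Cossart–Piltant.** Conditional on the named fact `CossartPiltant2019`: the
conclusion of the stub holds for every integral separated finite-type `X/k` of dimension `≤ 3`, with no F-singularity hypothesis.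
[OURS · conditional on the named fact; cite: CossartPiltant2019, Thm. 1.1] -/
theorem quotientModel_of_cossartPiltant2019_of_dim_le_three (hCP : CossartPiltant2019.{0}) (p : ℕ) (k : Type) [Field k]
    [CharP k p] (X : Scheme.{0}) (f : X ⟶ Spec (.of k)) [IsSeparated f] [LocallyOfFiniteType f] [QuasiCompact f]
    [IsIntegral X] (hdim : topologicalKrullDim X ≤ 3) :
    ∃ (X' : Scheme.{0}) (π : X' ⟶ X), IsProper π ∧ IsBirational π ∧ IsIntegral X' ∧
      ∀ x : X', ∃ (A : Type) (_ : AddCommGroup A) (_ : Finite A) (_ : DecidableEq A)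
        (S : Type) (_ : CommRing S) (_ : Algebra k S) (𝒮 : A → Submodule k S)
        (_ : GradedAlgebra 𝒮), Algebra.FiniteType k S ∧ IsRegularRing S ∧
        ∃ φ : Spec (.of (𝒮 0)) ⟶ X', Etale φ ∧ x ∈ Set.range φ ∧
          φ ≫ π ≫ f = Spec.map (CommRingCat.ofHom (algebraMap k (𝒮 0))) :=
  quotientModel_of_hasResolution k X f (hasResolution_of_dim_le_three hCP (p := p) k X f hdim)

end Summit.ResolutionOfSingularities.ResolutionOfSingularities.Theorems.FRationalResolution

end
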